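import Literature.Topology.FourManifolds.CerfPolynomialDirections
import HarnessLib

/-!
# Multi-point spanning by ambient polynomials (the hypothesis of Thom's multijet transversality
# theorem in Cerf's Ch. II, for height functions of an immersed moving surface)

Topic `Literature/Topology/FourManifolds` (programme of the fact
`Literature.Topology.FourManifolds.cerf_pi0DiffDisc_relBoundary_three`, brick C1).  The genericity
conditions `C₁`–`C₅` of Cerf (LNM 53 (1968), Ch. II §2, Déf. 2) concern pairs, triples and
quadruples of distinct critical points of one slice; `CerfExcellentPaths.lean` derives them for
a.e. member of a finite-dimensional family from the hypothesis that the perturbation directions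
realise every tuple of 2-jets at admissible tuples of points simultaneously ("transversalité au
but" of the multijet).  `CerfPolynomialDirections.surjective_D012_polyDir` proved the one-point
case for the monomials `X^α ∘ Φ` of the ambient `ℝ³`; this file proves the multi-point case by
polynomial interpolation of 2-jets:

* `jetOf f z = (f z, (p, q), (r, s, t))`, its additivity (`jetOf_sum`) and the Leibniz rule in jet
  form (`jetOf_mul`, with the symmetrised product `symProd` of the first partials); a product
  with a factor of vanishing 2-jet has vanishing 2-jet, the cube of a function vanishing at `z`
  has vanishing 2-jet at `z` (`jetOf_cube_eq_zero`);
* `exists_poly_jetOf_eq` — polynomial form of the one-point spanning (degree `≤ 2`), and its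
  twisted form `exists_poly_jetOf_mul_eq` (prescribe the jet of `q ∘ Φ · b` when `b z = 1`);
* `exists_bump` — for finitely many distinct points `P_k` of `ℝ³`, a polynomial `B_k` of degree
  `≤ 3 (m - 1)` with `B_k (P_k) = 1` whose composition with ANY smooth chart reading through
  `P_l`, `l ≠ k`, has vanishing 2-jet there (product of cubes of normalised affine functionals);
* `exists_poly_jetOf_eq_forall` — **simultaneous interpolation of 2-jets**: at finitely many
  points with pairwise distinct images, each an immersive point of its (smooth) chart reading,
  one polynomial of degree `≤ 3 (m - 1) + 2` realises any prescribed 2-jets;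
* `surjective_D012_polyDir_pair / _triple / _quadruple` — the spanning hypotheses of
  `ae_transverse_double`, `ae_no_triple_value`, `ae_no_degenerate_and_double`, `ae_no_two_doubles`
  for the monomial family `polyDir Φ` of degree `d ≥ 5, 8, 11`.

## References
* [CerfDiffeoSphere1968] J. Cerf, *Sur les difféomorphismes de la sphère de dimension trois
  (Γ₄ = 0)*, LNM 53 (1968), Ch. II §1 (Thom's transversality theorems, multijets) and §2, Déf. 2.
-/

noncomputable section

open Set Function Filter Module
open scoped ContDiff Topology BigOperators

namespace Literature.Topology.FourManifolds

namespace CerfPath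

open Literature.Analysis.Calculus Literature.Analysis.Calculus.MvPoly
  Literature.Analysis.Calculus.ParametricTransversality

/-- Local notation: the model plane. -/
local notation "𝔼²" => EuclideanSpace ℝ (Fin 2)
/-- Local notation: the ambient space. -/
local notation "𝔼³" => EuclideanSpace ℝ (Fin 3)
/-- Local notation: the space of 2-jets `(value, (p, q), (r, s, t))`. -/
local notation "𝕁" => ℝ × (Fin 2 → ℝ) × (Fin 3 → ℝ)

variable {d : ℕ}

/-! ### Evaluation of powers and products of polynomials -/

/-- `toFun` of a power. [folklore] -/
theorem toFun_pow (p : MvPolynomial (Fin 3) ℝ) (n : ℕ) (X : 𝔼³) :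
    toFun (p ^ n) X = toFun p X ^ n := by
  simp [toFun_apply, map_pow]

/-- `toFun` of a finite product. [folklore] -/
theorem toFun_prod {κ : Type*} (s : Finset κ) (f : κ → MvPolynomial (Fin 3) ℝ) (X : 𝔼³) :
    toFun (∏ k ∈ s, f k) X = ∏ k ∈ s, toFun (f k) X := by
  simp [toFun_apply, map_prod]

/-! ### The 2-jet of a function at a point -/

/-- The 2-jet `(f z, (p, q), (r, s, t))` of `f(λ, x, y)` at `z` (the target of Cerf's `f⁽²⁾`
restricted to the slice coordinates). [cite: CerfDiffeoSphere1968, Ch. II §2, (6)] -/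
def jetOf (f : ℝ × 𝔼² → ℝ) (z : ℝ × 𝔼²) : 𝕁 := (f z, d1 f z, jet2 f z)

/-- Unfolding of `jetOf`. [folklore] -/
theorem jetOf_apply (f : ℝ × 𝔼² → ℝ) (z : ℝ × 𝔼²) : jetOf f z = (f z, d1 f z, jet2 f z) := rfl

/-- A 2-jet vanishes iff its three components do. [folklore] -/
theorem jetOf_eq_zero_iff (f : ℝ × 𝔼² → ℝ) (z : ℝ × 𝔼²) :
    jetOf f z = 0 ↔ f z = 0 ∧ d1 f z = 0 ∧ jet2 f z = 0 := by
  simp [jetOf, Prod.ext_iff]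

/-- **Additivity of the 2-jet** over a finite sum of `C²` functions. [folklore] -/
theorem jetOf_sum {κ : Type*} [Fintype κ] {f : κ → ℝ × 𝔼² → ℝ} (hf : ∀ k, ContDiff ℝ 2 (f k))
    (z : ℝ × 𝔼²) : jetOf (fun y => ∑ k, f k y) z = ∑ k, jetOf (f k) z := by
  have hfun : (fun y => ∑ k, f k y) = perturb 0 f (fun _ => 1) := by
    funext y; simp [perturb_apply]
  have h1 : ∀ k, Differentiable ℝ (f k) := fun k => (hf k).differentiable two_ne_zero
  rw [hfun, jetOf_apply, perturb_zero_eq_D0, d1_perturb_zero_eq_D1 h1, jet2_perturb_zero_eq_D2 hf,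
    D0_apply, D1_apply, D2_apply]
  refine Prod.ext ?_ (Prod.ext ?_ ?_)
  · simp [Prod.fst_sum, jetOf]
  · simp [Prod.fst_sum, Prod.snd_sum, jetOf]
  · simp [Prod.snd_sum, jetOf]

/-- The symmetrised product of two covectors in the coordinates `(r, s, t)`:
`(2 p p', p q' + q p', 2 q q')` — the cross term of the Leibniz rule for second partials.
[folklore] -/
def symProd (p q : Fin 2 → ℝ) : Fin 3 → ℝ :=
  ![2 * (p 0 * q 0), p 0 * q 1 + p 1 * q 0, 2 * (p 1 * q 1)]

/-- `symProd 0 q = 0`. [folklore] -/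
@[simp] theorem symProd_zero_left (q : Fin 2 → ℝ) : symProd 0 q = 0 := by
  funext m; fin_cases m <;> simp [symProd]

/-- `symProd p 0 = 0`. [folklore] -/
@[simp] theorem symProd_zero_right (p : Fin 2 → ℝ) : symProd p 0 = 0 := by
  funext m; fin_cases m <;> simp [symProd]

/-- **Leibniz rule in jet form**: the 2-jet of a product of `C²` functions.
[folklore] -/
theorem jetOf_mul {a b : ℝ × 𝔼² → ℝ} (ha : ContDiff ℝ 2 a) (hb : ContDiff ℝ 2 b) (z : ℝ × 𝔼²) :
    jetOf (fun y => a y * b y) z =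
      (a z * b z, a z • d1 b z + b z • d1 a z,
        a z • jet2 b z + b z • jet2 a z + symProd (d1 a z) (d1 b z)) := by
  have ha1 : Differentiable ℝ a := ha.differentiable two_ne_zero
  have hb1 : Differentiable ℝ b := hb.differentiable two_ne_zero
  refine Prod.ext rfl (Prod.ext ?_ ?_)
  · funext i
    simp [jetOf, d1_mul ha1 hb1, smul_eq_mul]
  · funext m
    fin_cases m <;> simp [jetOf, jet2, d2_mul ha hb, symProd] <;> ring

/-- A product whose LEFT factor has vanishing 2-jet has vanishing 2-jet. [folklore] -/
theorem jetOf_mul_eq_zero_of_left {a b : ℝ × 𝔼² → ℝ} (ha : ContDiff ℝ 2 a) (hb : ContDiff ℝ 2 b)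
    {z : ℝ × 𝔼²} (h : jetOf a z = 0) : jetOf (fun y => a y * b y) z = 0 := by
  rw [jetOf_eq_zero_iff] at h
  obtain ⟨h0, h1, h2⟩ := h
  rw [jetOf_mul ha hb, h0, h1, h2]
  simp

/-- A product whose RIGHT factor has vanishing 2-jet has vanishing 2-jet. [folklore] -/
theorem jetOf_mul_eq_zero_of_right {a b : ℝ × 𝔼² → ℝ} (ha : ContDiff ℝ 2 a) (hb : ContDiff ℝ 2 b)
    {z : ℝ × 𝔼²} (h : jetOf b z = 0) : jetOf (fun y => a y * b y) z = 0 := by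
  rw [jetOf_eq_zero_iff] at h
  obtain ⟨h0, h1, h2⟩ := h
  rw [jetOf_mul ha hb, h0, h1, h2]
  simp

/-- **The cube of a function vanishing at `z` has vanishing 2-jet at `z`.** [folklore] -/
theorem jetOf_cube_eq_zero {c : ℝ × 𝔼² → ℝ} (hc : ContDiff ℝ 2 c) {z : ℝ × 𝔼²} (h0 : c z = 0) :
    jetOf (fun y => c y ^ 3) z = 0 := by
  have hc1 : Differentiable ℝ c := hc.differentiable two_ne_zero
  have hsq : ContDiff ℝ 2 (fun y => c y * c y) := hc.mul hc
  have hfun : (fun y => c y ^ 3) = fun y => c y * (c y * c y) := by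
    funext y; ring
  have hd1 : d1 (fun y => c y * c y) z = 0 := by
    funext i
    rw [d1_mul hc1 hc1, h0]
    simp
  rw [hfun, jetOf_mul hc hsq]
  simp [h0, hd1]

/-! ### Polynomial form of the one-point spanning -/

section OnePoint

variable {Φ : ℝ × 𝔼² → 𝔼³}

/-- The polynomial with coefficient vector `p` on the bounded monomials `X^α`, `α ≤ d`.
[folklore] -/
def polyOf (p : MIdx d → ℝ) : MvPolynomial (Fin 3) ℝ :=
  ∑ α, MvPolynomial.C (p α) * monoPoly α

/-- `polyOf p` has degree `≤ d` in each variable. [folklore] -/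
theorem degreeOf_polyOf_le (p : MIdx d → ℝ) (i : Fin 3) : (polyOf p).degreeOf i ≤ d := by
  classical
  refine (MvPolynomial.degreeOf_sum_le i _ _).trans (Finset.sup_le fun α _ => ?_)
  refine (MvPolynomial.degreeOf_mul_le i _ _).trans ?_
  rw [MvPolynomial.degreeOf_C, zero_add, monoPoly,
    MvPolynomial.degreeOf_monomial_eq _ _ one_ne_zero]
  have h : ((α i : ℕ)) ≤ d := Nat.lt_succ_iff.1 (α i).isLt
  simpa [expo] using h

/-- `polyOf p ∘ Φ` is the member `perturb 0 (polyDir Φ) p` of the monomial family.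
[folklore] -/
theorem toFun_polyOf_comp (p : MIdx d → ℝ) (Φ : ℝ × 𝔼² → 𝔼³) :
    (fun y => toFun (polyOf p) (Φ y)) = perturb 0 (polyDir Φ) p := by
  funext y
  rw [perturb_apply, Pi.zero_apply, zero_add, polyOf, toFun_sum]
  refine Finset.sum_congr rfl fun α _ => ?_
  rw [toFun_mul, toFun_C, polyDir_apply]

/-- `D012 (polyDir Φ) z p` is the 2-jet of `polyOf p ∘ Φ` at `z`. [folklore] -/
theorem D012_polyDir_apply (hΦ : ContDiff ℝ ∞ Φ) (z : ℝ × 𝔼²) (p : MIdx d → ℝ) :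
    D012 (polyDir (d := d) Φ) z p = jetOf (fun y => toFun (polyOf p) (Φ y)) z := by
  have hw1 : ∀ α : MIdx d, Differentiable ℝ (polyDir Φ α) := fun α =>
    (contDiff_polyDir hΦ α).differentiable (by simp)
  have hw2 : ∀ α : MIdx d, ContDiff ℝ 2 (polyDir Φ α) := fun α =>
    (contDiff_polyDir hΦ α).of_le two_le_infty
  rw [toFun_polyOf_comp, jetOf_apply, D012_apply, perturb_zero_eq_D0, d1_perturb_zero_eq_D1 hw1,
    jet2_perturb_zero_eq_D2 hw2]

/-- `D012 (polyDir Φ) z` at the coefficient vector of a polynomial `q` of degree `≤ d` is the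
2-jet of `q ∘ Φ` at `z`. [folklore] -/
theorem D012_polyDir_coeff (hΦ : ContDiff ℝ ∞ Φ) {q : MvPolynomial (Fin 3) ℝ}
    (hq : ∀ i, q.degreeOf i ≤ d) (z : ℝ × 𝔼²) :
    D012 (polyDir (d := d) Φ) z (fun α : MIdx d => q.coeff (expo α)) =
      jetOf (fun y => toFun q (Φ y)) z := by
  have hw1 : ∀ α : MIdx d, Differentiable ℝ (polyDir Φ α) := fun α =>
    (contDiff_polyDir hΦ α).differentiable (by simp)
  have hw2 : ∀ α : MIdx d, ContDiff ℝ 2 (polyDir Φ α) := fun α =>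
    (contDiff_polyDir hΦ α).of_le two_le_infty
  have hfun : (fun y => toFun q (Φ y)) =
      perturb 0 (polyDir (d := d) Φ) fun α : MIdx d => q.coeff (expo α) := by
    funext y; rw [perturb_apply, Pi.zero_apply, zero_add, toFun_eq_sum_coeff hq]; rfl
  rw [hfun, jetOf_apply, D012_apply, perturb_zero_eq_D0, d1_perturb_zero_eq_D1 hw1,
    jet2_perturb_zero_eq_D2 hw2]

/-- **One-point spanning, polynomial form**: at an immersive point of a smooth chart reading,
every 2-jet is the 2-jet of `q ∘ Φ` for a polynomial `q` of degree `≤ 2` in each variable.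
[cite: CerfDiffeoSphere1968, Ch. II §1, théorème de transversalité local] -/
theorem exists_poly_jetOf_eq (hΦ : ContDiff ℝ ∞ Φ) {z : ℝ × 𝔼²}
    (himm : LinearIndependent ℝ (fun i : Fin 2 => fderiv ℝ Φ z (dir i))) (v : 𝕁) :
    ∃ q : MvPolynomial (Fin 3) ℝ, (∀ i, q.degreeOf i ≤ 2) ∧
      jetOf (fun y => toFun q (Φ y)) z = v := by
  obtain ⟨p, hp⟩ := surjective_D012_polyDir (d := 2) le_rfl hΦ himm v
  exact ⟨polyOf p, degreeOf_polyOf_le p, by rw [← D012_polyDir_apply hΦ z p, hp]⟩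

/-- **Twisted one-point spanning**: if `b` is `C²` with `b z = 1`, every 2-jet is the 2-jet of
`(q ∘ Φ) · b` at `z` for a polynomial `q` of degree `≤ 2` (the Leibniz rule is a unipotent
change of jet coordinates). [folklore] -/
theorem exists_poly_jetOf_mul_eq (hΦ : ContDiff ℝ ∞ Φ) {z : ℝ × 𝔼²}
    (himm : LinearIndependent ℝ (fun i : Fin 2 => fderiv ℝ Φ z (dir i))) {b : ℝ × 𝔼² → ℝ}
    (hb : ContDiff ℝ 2 b) (hb1 : b z = 1) (v : 𝕁) :
    ∃ q : MvPolynomial (Fin 3) ℝ, (∀ i, q.degreeOf i ≤ 2) ∧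
      jetOf (fun y => toFun q (Φ y) * b y) z = v := by
  obtain ⟨v₀, v₁, v₂⟩ := v
  obtain ⟨q, hqd, hq⟩ := exists_poly_jetOf_eq hΦ himm
    (v₀, v₁ - v₀ • d1 b z, v₂ - v₀ • jet2 b z - symProd (v₁ - v₀ • d1 b z) (d1 b z))
  refine ⟨q, hqd, ?_⟩
  have ha : ContDiff ℝ 2 fun y => toFun q (Φ y) := by
    have h := (contDiff_toFun (m := 2) q).comp (hΦ.of_le two_le_infty)
    exact h
  rw [jetOf_mul ha hb]
  simp only [jetOf, Prod.mk.injEq] at hq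
  obtain ⟨h0, h1, h2⟩ := hq
  rw [h0, h1, h2, hb1]
  refine Prod.ext (by simp) (Prod.ext ?_ ?_)
  · show v₀ • d1 b z + (1 : ℝ) • (v₁ - v₀ • d1 b z) = v₁
    rw [one_smul]; abel
  · show v₀ • jet2 b z + (1 : ℝ) • (v₂ - v₀ • jet2 b z - symProd (v₁ - v₀ • d1 b z) (d1 b z)) +
        symProd (v₁ - v₀ • d1 b z) (d1 b z) = v₂
    rw [one_smul]; abel

end OnePoint

/-! ### Bump polynomials: flat at the other points -/

/-- **Bump polynomials.**  For finitely many pairwise distinct points `P_k` of `ℝ³` and an index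
`k`, the product over `l ≠ k` of the cubes of the normalised affine functionals
`X ↦ ⟨P_k - P_l, X - P_l⟩ / ‖P_k - P_l‖²` is a polynomial of degree `≤ 3 (m - 1)` in each
variable, equal to `1` at `P_k`, whose composition with any smooth chart reading `Φ` through
`P_l` (`l ≠ k`, `Φ z = P_l`) has vanishing 2-jet at `z`. [folklore] -/
theorem exists_bump {κ : Type*} [Fintype κ] [DecidableEq κ] (P : κ → 𝔼³)
    (hP : ∀ k l, k ≠ l → P k ≠ P l) (k : κ) :
    ∃ B : MvPolynomial (Fin 3) ℝ, (∀ i, B.degreeOf i ≤ 3 * (Fintype.card κ - 1)) ∧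
      toFun B (P k) = 1 ∧
      ∀ l, l ≠ k → ∀ {Φ : ℝ × 𝔼² → 𝔼³}, ContDiff ℝ ∞ Φ → ∀ {z : ℝ × 𝔼²}, Φ z = P l →
        jetOf (fun y => toFun B (Φ y)) z = 0 := by
  classical
  -- the normalised affine functionals, in polynomial form
  have hΛ : ∀ l, ∃ Λ : MvPolynomial (Fin 3) ℝ, (∀ i, Λ.degreeOf i ≤ 1) ∧
      ∀ X, toFun Λ X = ((‖P k - P l‖ ^ 2)⁻¹ • innerSL ℝ (P k - P l)) (X - P l) := fun l =>
    exists_poly_affine _ _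
  choose Λ hΛd hΛf using hΛ
  refine ⟨∏ l ∈ Finset.univ.erase k, Λ l ^ 3, fun i => ?_, ?_, ?_⟩
  · -- degree
    refine (MvPolynomial.degreeOf_prod_le i _ _).trans ?_
    calc ∑ l ∈ Finset.univ.erase k, (Λ l ^ 3).degreeOf i
        ≤ ∑ l ∈ Finset.univ.erase k, 3 := Finset.sum_le_sum fun l _ =>
          (MvPolynomial.degreeOf_pow_le i _ _).trans (by
            have h := hΛd l i
            calc 3 * (Λ l).degreeOf i ≤ 3 * 1 := Nat.mul_le_mul_left 3 h
              _ = 3 := rfl)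
      _ = 3 * (Fintype.card κ - 1) := by
          rw [Finset.sum_const, smul_eq_mul, Finset.card_erase_of_mem (Finset.mem_univ k),
            Finset.card_univ, mul_comm]
  · -- value at `P k`
    rw [toFun_prod]
    refine Finset.prod_eq_one fun l hl => ?_
    have hne : P k - P l ≠ 0 := sub_ne_zero.2 (hP k l (Finset.ne_of_mem_erase hl).symm)
    have hn : ‖P k - P l‖ ^ 2 ≠ 0 := pow_ne_zero 2 (norm_ne_zero_iff.2 hne)
    rw [toFun_pow, hΛf]
    have h1 : ((‖P k - P l‖ ^ 2)⁻¹ • innerSL ℝ (P k - P l)) (P k - P l) = 1 := by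
      change (‖P k - P l‖ ^ 2)⁻¹ * innerSL ℝ (P k - P l) (P k - P l) = 1
      rw [innerSL_apply_apply, real_inner_self_eq_norm_sq, inv_mul_cancel₀ hn]
    rw [h1, one_pow]
  · -- flatness at `P l`, `l ≠ k`
    intro l hl Φ hΦ z hz
    have hmem : l ∈ Finset.univ.erase k := Finset.mem_erase.2 ⟨hl, Finset.mem_univ l⟩
    have hsplit : (fun y => toFun (∏ l ∈ Finset.univ.erase k, Λ l ^ 3) (Φ y)) =
        fun y => toFun (Λ l) (Φ y) ^ 3 *
          toFun (∏ l' ∈ (Finset.univ.erase k).erase l, Λ l' ^ 3) (Φ y) := by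
      funext y
      rw [← Finset.mul_prod_erase _ _ hmem, toFun_mul, toFun_pow]
    rw [hsplit]
    have hc : ContDiff ℝ 2 fun y => toFun (Λ l) (Φ y) := by
      have h := (contDiff_toFun (m := 2) (Λ l)).comp (hΦ.of_le two_le_infty)
      exact h
    have hrest : ContDiff ℝ 2 fun y =>
        toFun (∏ l' ∈ (Finset.univ.erase k).erase l, Λ l' ^ 3) (Φ y) := by
      have h := (contDiff_toFun (m := 2) (∏ l' ∈ (Finset.univ.erase k).erase l, Λ l' ^ 3)).comp
        (hΦ.of_le two_le_infty)
      exact h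
    refine jetOf_mul_eq_zero_of_left (hc.pow 3) hrest (jetOf_cube_eq_zero hc ?_)
    show toFun (Λ l) (Φ z) = 0
    rw [hΛf, hz, sub_self, map_zero]

/-! ### Simultaneous interpolation of 2-jets -/

/-- **Simultaneous interpolation of 2-jets by one ambient polynomial (the hypothesis of Thom's
multijet transversality theorem, finite-dimensional form).**  Let `Φ_k` be finitely many smooth
chart readings `ℝ × ℝ² → ℝ³` and `z_k` points with pairwise distinct images `Φ_k (z_k)`, each an
immersive point of its slice.  Then for any prescribed 2-jets `v_k` there is ONE polynomial `q`
of degree `≤ 3 (m - 1) + 2` in each variable with `jetOf (q ∘ Φ_k) (z_k) = v_k` for every `k`: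
`q = ∑ Q_k B_k` with `B_k` the bump polynomials and `Q_k` the twisted one-point solutions.
[cite: CerfDiffeoSphere1968, Ch. II §1, théorèmes de transversalité de Thom (multijets)] -/
theorem exists_poly_jetOf_eq_forall {κ : Type*} [Fintype κ] [DecidableEq κ]
    {Φ : κ → ℝ × 𝔼² → 𝔼³} (hΦ : ∀ k, ContDiff ℝ ∞ (Φ k)) {z : κ → ℝ × 𝔼²}
    (himm : ∀ k, LinearIndependent ℝ (fun i : Fin 2 => fderiv ℝ (Φ k) (z k) (dir i)))
    (hdist : ∀ k l, k ≠ l → Φ k (z k) ≠ Φ l (z l)) (v : κ → 𝕁) :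
    ∃ q : MvPolynomial (Fin 3) ℝ, (∀ i, q.degreeOf i ≤ 3 * (Fintype.card κ - 1) + 2) ∧
      ∀ k, jetOf (fun y => toFun q (Φ k y)) (z k) = v k := by
  classical
  have hB := fun k => exists_bump (fun k => Φ k (z k)) hdist k
  choose B hBd hB1 hB0 using hB
  have hBc : ∀ k l, ContDiff ℝ 2 fun y => toFun (B k) (Φ l y) := fun k l => by
    have h := (contDiff_toFun (m := 2) (B k)).comp ((hΦ l).of_le two_le_infty)
    exact h
  -- twisted one-point solutions
  have hQ : ∀ k, ∃ Q : MvPolynomial (Fin 3) ℝ, (∀ i, Q.degreeOf i ≤ 2) ∧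
      jetOf (fun y => toFun Q (Φ k y) * toFun (B k) (Φ k y)) (z k) = v k := fun k =>
    exists_poly_jetOf_mul_eq (hΦ k) (himm k) (hBc k k) (hB1 k) (v k)
  choose Q hQd hQv using hQ
  have hQc : ∀ k l, ContDiff ℝ 2 fun y => toFun (Q k) (Φ l y) := fun k l => by
    have h := (contDiff_toFun (m := 2) (Q k)).comp ((hΦ l).of_le two_le_infty)
    exact h
  refine ⟨∑ k, Q k * B k, fun i => ?_, fun l => ?_⟩
  · refine (MvPolynomial.degreeOf_sum_le i _ _).trans (Finset.sup_le fun k _ => ?_)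
    refine (MvPolynomial.degreeOf_mul_le i _ _).trans ?_
    have h1 := hQd k i
    have h2 := hBd k i
    omega
  · have hfun : (fun y => toFun (∑ k, Q k * B k) (Φ l y)) =
        fun y => ∑ k, toFun (Q k) (Φ l y) * toFun (B k) (Φ l y) := by
      funext y
      rw [toFun_sum]
      simp only [toFun_mul]
    rw [hfun, jetOf_sum (f := fun k y => toFun (Q k) (Φ l y) * toFun (B k) (Φ l y))
      (fun k => (hQc k l).mul (hBc k l))]
    rw [Finset.sum_eq_single l (fun k _ hkl => ?_) (fun h => absurd (Finset.mem_univ l) h)]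
    · exact hQv l
    · exact jetOf_mul_eq_zero_of_right (hQc k l) (hBc k l) (hB0 k l (Ne.symm hkl) (hΦ l) rfl)

/-! ### The spanning hypotheses of `CerfExcellentPaths` for the monomial family -/

section Spanning

variable {Φa Φb Φc Φd : ℝ × 𝔼² → 𝔼³} {za zb zc zd : ℝ × 𝔼²}

/-- **Pairs** (hypothesis of `ae_transverse_double`, `ae_no_degenerate_and_double`): at two
immersive points with distinct images the monomials of degree `≤ d`, `d ≥ 5`, realise every
pair of 2-jets. [cite: CerfDiffeoSphere1968, Ch. II §1–2, Déf. 2 (C₁), (C₄)] -/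
theorem surjective_D012_polyDir_pair (hd : 5 ≤ d) (hΦa : ContDiff ℝ ∞ Φa)
    (hΦb : ContDiff ℝ ∞ Φb)
    (ha : LinearIndependent ℝ (fun i : Fin 2 => fderiv ℝ Φa za (dir i)))
    (hb : LinearIndependent ℝ (fun i : Fin 2 => fderiv ℝ Φb zb (dir i)))
    (hab : Φa za ≠ Φb zb) :
    Surjective ((D012 (polyDir (d := d) Φa) za).prod (D012 (polyDir (d := d) Φb) zb)) := by
  rintro ⟨va, vb⟩
  have hΦ : ∀ k : Fin 2, ContDiff ℝ ∞ (![Φa, Φb] k) := by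
    intro k; fin_cases k <;> assumption
  have himm : ∀ k : Fin 2, LinearIndependent ℝ
      (fun i : Fin 2 => fderiv ℝ (![Φa, Φb] k) (![za, zb] k) (dir i)) := by
    intro k; fin_cases k <;> assumption
  have hdist : ∀ k l : Fin 2, k ≠ l → ![Φa, Φb] k (![za, zb] k) ≠ ![Φa, Φb] l (![za, zb] l) := by
    intro k l hkl
    fin_cases k <;> fin_cases l
    · exact absurd rfl hkl
    · simpa using hab
    · simpa using hab.symm
    · exact absurd rfl hkl
  obtain ⟨q, hqd, hqv⟩ := exists_poly_jetOf_eq_forall hΦ himm hdist ![va, vb]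
  have hqd' : ∀ i, q.degreeOf i ≤ d := fun i =>
    (hqd i).trans (by simp only [Fintype.card_fin]; omega)
  refine ⟨fun α => q.coeff (expo α), ?_⟩
  rw [ContinuousLinearMap.prod_apply, D012_polyDir_coeff hΦa hqd', D012_polyDir_coeff hΦb hqd']
  exact Prod.ext (by simpa using hqv 0) (by simpa using hqv 1)

/-- **Triples** (hypothesis of `ae_no_triple_value`): at three immersive points with pairwise
distinct images the monomials of degree `≤ d`, `d ≥ 8`, realise every triple of 2-jets.
[cite: CerfDiffeoSphere1968, Ch. II §1–2, Déf. 2 (C₃)] -/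
theorem surjective_D012_polyDir_triple (hd : 8 ≤ d) (hΦa : ContDiff ℝ ∞ Φa)
    (hΦb : ContDiff ℝ ∞ Φb) (hΦc : ContDiff ℝ ∞ Φc)
    (ha : LinearIndependent ℝ (fun i : Fin 2 => fderiv ℝ Φa za (dir i)))
    (hb : LinearIndependent ℝ (fun i : Fin 2 => fderiv ℝ Φb zb (dir i)))
    (hc : LinearIndependent ℝ (fun i : Fin 2 => fderiv ℝ Φc zc (dir i)))
    (hab : Φa za ≠ Φb zb) (hac : Φa za ≠ Φc zc) (hbc : Φb zb ≠ Φc zc) :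
    Surjective ((D012 (polyDir (d := d) Φa) za).prod
      ((D012 (polyDir (d := d) Φb) zb).prod (D012 (polyDir (d := d) Φc) zc))) := by
  rintro ⟨va, vb, vc⟩
  have hΦ : ∀ k : Fin 3, ContDiff ℝ ∞ (![Φa, Φb, Φc] k) := by
    intro k; fin_cases k <;> assumption
  have himm : ∀ k : Fin 3, LinearIndependent ℝ
      (fun i : Fin 2 => fderiv ℝ (![Φa, Φb, Φc] k) (![za, zb, zc] k) (dir i)) := by
    intro k; fin_cases k <;> assumption
  have hdist : ∀ k l : Fin 3, k ≠ l →
      ![Φa, Φb, Φc] k (![za, zb, zc] k) ≠ ![Φa, Φb, Φc] l (![za, zb, zc] l) := by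
    intro k l hkl
    fin_cases k <;> fin_cases l
    · exact absurd rfl hkl
    · simpa using hab
    · simpa using hac
    · simpa using hab.symm
    · exact absurd rfl hkl
    · simpa using hbc
    · simpa using hac.symm
    · simpa using hbc.symm
    · exact absurd rfl hkl
  obtain ⟨q, hqd, hqv⟩ := exists_poly_jetOf_eq_forall hΦ himm hdist ![va, vb, vc]
  have hqd' : ∀ i, q.degreeOf i ≤ d := fun i =>
    (hqd i).trans (by simp only [Fintype.card_fin]; omega)
  refine ⟨fun α => q.coeff (expo α), ?_⟩
  rw [ContinuousLinearMap.prod_apply, ContinuousLinearMap.prod_apply, D012_polyDir_coeff hΦa hqd',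
    D012_polyDir_coeff hΦb hqd', D012_polyDir_coeff hΦc hqd']
  exact Prod.ext (by simpa using hqv 0) (Prod.ext (by simpa using hqv 1) (by simpa using hqv 2))

/-- **Quadruples** (hypothesis of `ae_no_two_doubles`): at four immersive points with pairwise
distinct images the monomials of degree `≤ d`, `d ≥ 11`, realise every quadruple of 2-jets.
[cite: CerfDiffeoSphere1968, Ch. II §1–2, Déf. 2 (C₅)] -/
theorem surjective_D012_polyDir_quadruple (hd : 11 ≤ d) (hΦa : ContDiff ℝ ∞ Φa)
    (hΦb : ContDiff ℝ ∞ Φb) (hΦc : ContDiff ℝ ∞ Φc) (hΦd : ContDiff ℝ ∞ Φd)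
    (ha : LinearIndependent ℝ (fun i : Fin 2 => fderiv ℝ Φa za (dir i)))
    (hb : LinearIndependent ℝ (fun i : Fin 2 => fderiv ℝ Φb zb (dir i)))
    (hc : LinearIndependent ℝ (fun i : Fin 2 => fderiv ℝ Φc zc (dir i)))
    (hd' : LinearIndependent ℝ (fun i : Fin 2 => fderiv ℝ Φd zd (dir i)))
    (hab : Φa za ≠ Φb zb) (hac : Φa za ≠ Φc zc) (had : Φa za ≠ Φd zd)
    (hbc : Φb zb ≠ Φc zc) (hbd : Φb zb ≠ Φd zd) (hcd : Φc zc ≠ Φd zd) :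
    Surjective (((D012 (polyDir (d := d) Φa) za).prod (D012 (polyDir (d := d) Φb) zb)).prod
      ((D012 (polyDir (d := d) Φc) zc).prod (D012 (polyDir (d := d) Φd) zd))) := by
  rintro ⟨⟨va, vb⟩, ⟨vc, vd⟩⟩
  have hΦ : ∀ k : Fin 4, ContDiff ℝ ∞ (![Φa, Φb, Φc, Φd] k) := by
    intro k; fin_cases k <;> assumption
  have himm : ∀ k : Fin 4, LinearIndependent ℝ
      (fun i : Fin 2 => fderiv ℝ (![Φa, Φb, Φc, Φd] k) (![za, zb, zc, zd] k) (dir i)) := by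
    intro k; fin_cases k <;> assumption
  have hdist : ∀ k l : Fin 4, k ≠ l →
      ![Φa, Φb, Φc, Φd] k (![za, zb, zc, zd] k) ≠ ![Φa, Φb, Φc, Φd] l (![za, zb, zc, zd] l) := by
    intro k l hkl
    fin_cases k <;> fin_cases l
    · exact absurd rfl hkl
    · simpa using hab
    · simpa using hac
    · simpa using had
    · simpa using hab.symm
    · exact absurd rfl hkl
    · simpa using hbc
    · simpa using hbd
    · simpa using hac.symm
    · simpa using hbc.symm
    · exact absurd rfl hkl
    · simpa using hcd
    · simpa using had.symm
    · simpa using hbd.symm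
    · simpa using hcd.symm
    · exact absurd rfl hkl
  obtain ⟨q, hqd, hqv⟩ := exists_poly_jetOf_eq_forall hΦ himm hdist ![va, vb, vc, vd]
  have hqd' : ∀ i, q.degreeOf i ≤ d := fun i =>
    (hqd i).trans (by simp only [Fintype.card_fin]; omega)
  refine ⟨fun α => q.coeff (expo α), ?_⟩
  rw [ContinuousLinearMap.prod_apply, ContinuousLinearMap.prod_apply, ContinuousLinearMap.prod_apply,
    D012_polyDir_coeff hΦa hqd', D012_polyDir_coeff hΦb hqd', D012_polyDir_coeff hΦc hqd',
    D012_polyDir_coeff hΦd hqd']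
  exact Prod.ext (Prod.ext (by simpa using hqv 0) (by simpa using hqv 1))
    (Prod.ext (by simpa using hqv 2) (by simpa using hqv 3))

end Spanning

end CerfPath

end Literature.Topology.FourManifolds
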